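import Literature.AnabelianGeometry.EtaleTheta.RealificationExtension
import Literature.AnabelianGeometry.EtaleTheta.PerfectionPrimes

/-!
# [EtTh] Lemma 3.5 (i), (ii), the "`P^rlf`" portion — packaged statements (discharge)

Source: S. Mochizuki, *The étale theta function and its Frobenioid-theoretic manifestations*,
Publ. RIMS **45** (2009) [MochizukiEtTh2009], Lemma 3.5, PDF pp. 75–76 (printed 301–302).

"Let `P`, `Q` be perf-factorial monoids such that: (a) `P` is a submonoid of `Q`; (b) `P` is
group-saturated in `Q`; (c) `ℝ` supports `Q`. Then: (i) The inclusion `P ↪ Q` extends uniquely to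
inclusions `P^pf ↪ Q`, `P^rlf ↪ Q`. (ii) Relative to the inclusions of (i), `P^pf`, `P^rlf` are
group-saturated in `Q`."

This file states and proves the `P^rlf` portion over the tree's vocabulary, with NO residual
hypothesis beyond the printed ones: `Supports Q .R` ([FrdI] Def. 2.4 (ii)), `IsPerfFactorial P`
([FrdI] Def. 2.4 (i)), `IsGroupSaturated P` ([EtTh] §0) — the monoprimality of the `P^pf_𝔮` used by the
construction (`RealificationExtension.lean`) is `PerfectionPrimes.isMonoprime_pfAt`:

* `existsUnique_rlf_extension`, `rlf_extension_dvd_iff`, `rlf_extension_injective`,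
  `isGroupSaturated_mrange_rlf_extension` — for the tree's realification `hP.Rlf`;
* `rlf_extension_via`, `isGroupSaturated_rlf_extension_via` — the same transported to ANY
  `ρ : P → R` exhibiting `R` as the realification (`e : R ≅ P^rlf` with `e ∘ ρ = (P → P^pf → P^rlf)`),
  i.e. the hypotheses of the §3 statement file's named facts `Lemma35_i`, `Lemma35_ii`
  (`DivisorMonoids.lean`, seat abc-iut-L2-t3) once its [FrdI]-vocabulary stub is instantiated with the
  tree's notions (`IsRealificationVia`, seat abc-iut-L2-t3 / glue seat abc-iut-L6-t12).

The `P^pf` portion is `SubmonoidPerfection.lean` (seat abc-iut-L6-t12). Proof-only (no definitions).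
Seat abc-iut-L2-d2 (cell abc-iut, node EtTh:Lem3.5 rlf portion, step 5/5).
-/

namespace Literature.AnabelianGeometry.EtaleTheta

namespace Lemma35

open Literature.AlgebraicGeometry.Frobenioids Function

universe u

variable {Q : Type u} [CommMonoid Q] (P : Submonoid Q)

/-! ### Lemma 3.5 (i), (ii) for the tree's `P^rlf` -/

/-- **Lemma 3.5 (i), `P^rlf` portion — existence and uniqueness** (pp. 75–76): if `ℝ` supports `Q` and
the submonoid `P ⊆ Q` is perf-factorial, the inclusion `P ↪ Q` extends
UNIQUELY, through `P → P^pf → P^rlf`, to a homomorphism of monoids `P^rlf → Q`.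
[cite: MochizukiEtTh2009, Lem 3.5 p.75] -/
theorem existsUnique_rlf_extension (hR : Supports Q MonoidType.R) (hP : IsPerfFactorial P)
 :
    ∃! φ : hP.Rlf →* Q, φ.comp (hP.toRealification.comp (Perfection.of P)) = P.subtype := by
  have hQ : IsPerfect Q := hR.1
  obtain ⟨ι, hι⟩ := Lemma35.exists_extension P hQ
  obtain ⟨φ, hφ⟩ := exists_rlf_hom_comp_eq hP (PerfectionPrimes.isMonoprime_pfAt hP) ι hR
  refine ⟨φ, ?_, fun ψ hψ => ?_⟩
  · show φ.comp (hP.toRealification.comp (Perfection.of P)) = P.subtype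
    rw [← MonoidHom.comp_assoc, hφ, hι]
  · have hψι : ψ.comp hP.toRealification = ι :=
      Lemma35.extension_unique hQ _ _ (by rw [MonoidHom.comp_assoc]; exact hψ) hι
    exact rlf_hom_ext hP (PerfectionPrimes.isMonoprime_pfAt hP) ι hR ψ φ hψι hφ

/-- **Lemma 3.5 (i), `P^rlf` portion — order embedding** (p. 76): with `P` moreover group-saturated in
`Q`, every extension `φ : P^rlf → Q` of the inclusion reflects and preserves `≤`.
[cite: MochizukiEtTh2009, Lem 3.5 p.76] -/
theorem rlf_extension_dvd_iff (hR : Supports Q MonoidType.R) (hP : IsPerfFactorial P)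
    (hsat : IsGroupSaturated P)
    (φ : hP.Rlf →* Q) (hφ : φ.comp (hP.toRealification.comp (Perfection.of P)) = P.subtype)
    (x y : hP.Rlf) : φ x ∣ φ y ↔ x ∣ y := by
  have hQ : IsPerfect Q := hR.1
  refine ⟨fun h => ?_, map_dvd φ⟩
  have hι : (φ.comp hP.toRealification).comp (Perfection.of P) = P.subtype := by
    rw [MonoidHom.comp_assoc]; exact hφ
  exact dvd_of_rlf_hom_dvd hP (PerfectionPrimes.isMonoprime_pfAt hP) (φ.comp hP.toRealification)
    (Lemma35.extension_injective _ hι) (Lemma35.isGroupSaturated_mrange_extension hQ hsat _ hι) φ rfl h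

/-- **Lemma 3.5 (i), `P^rlf` portion — injectivity** (p. 76): "Thus, we conclude that `φ` is injective"
— for `P` group-saturated in `Q` (the crucial hypothesis, cf. Remark 3.5.2), every extension
`φ : P^rlf → Q` of the inclusion is injective. [cite: MochizukiEtTh2009, Lem 3.5 p.76] -/
theorem rlf_extension_injective (hR : Supports Q MonoidType.R) (hP : IsPerfFactorial P)
    (hsat : IsGroupSaturated P)
    (φ : hP.Rlf →* Q) (hφ : φ.comp (hP.toRealification.comp (Perfection.of P)) = P.subtype) :
    Injective φ := fun x y h =>
  RlfCoord.dvd_antisymm hP (PerfectionPrimes.isMonoprime_pfAt hP)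
    ((rlf_extension_dvd_iff P hR hP hsat φ hφ x y).mp h.dvd)
    ((rlf_extension_dvd_iff P hR hP hsat φ hφ y x).mp h.symm.dvd)

/-- **Lemma 3.5 (ii), `P^rlf` portion** (p. 75): "Relative to the inclusions of (i), … `P^rlf` [is]
group-saturated in `Q`" — for `P` group-saturated in `Q` with `ℝ` supporting `Q`.
[cite: MochizukiEtTh2009, Lem 3.5 p.75] -/
theorem isGroupSaturated_mrange_rlf_extension (hR : Supports Q MonoidType.R) (hP : IsPerfFactorial P)
    (hsat : IsGroupSaturated P)
    (φ : hP.Rlf →* Q) (hφ : φ.comp (hP.toRealification.comp (Perfection.of P)) = P.subtype) :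
    IsGroupSaturated (MonoidHom.mrange φ) := by
  rw [isGroupSaturated_iff']
  rintro q _ ⟨x, rfl⟩ _ ⟨y, rfl⟩ h
  have hyx : y ∣ x := (rlf_extension_dvd_iff P hR hP hsat φ hφ y x).mp ⟨q, by rw [mul_comm]; exact h.symm⟩
  obtain ⟨z, rfl⟩ := hyx
  refine ⟨z, RSupported.mul_left_cancel hR (x := φ y) ?_⟩
  rw [← map_mul, ← h, mul_comm]


/-! ### Transport to any realification `ρ : P → R ≅ P^rlf` -/

/-- Extensions along `ρ : P → R` correspond to extensions along `P → P^pf → P^rlf` when `e : R ≅ P^rlf`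
identifies `ρ` with the natural map. [cite: MochizukiEtTh2009, Lem 3.5 p.75] -/
private theorem comp_eq_subtype_iff (hP : IsPerfFactorial P) {R : Type u} [CommMonoid R] (ρ : P →* R)
    (e : R ≃* hP.Rlf) (he : ∀ m : P, e (ρ m) = hP.toRealification (Perfection.of P m)) (ι : R →* Q) :
    ι.comp ρ = P.subtype ↔
      (ι.comp e.symm.toMonoidHom).comp (hP.toRealification.comp (Perfection.of P)) = P.subtype := by
  constructor
  · intro h
    ext m
    show ι (e.symm (hP.toRealification (Perfection.of P m))) = m
    rw [← he m, MulEquiv.symm_apply_apply]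
    exact DFunLike.congr_fun h m
  · intro h
    ext m
    have := DFunLike.congr_fun h m
    simp only [MonoidHom.comp_apply, MulEquiv.coe_toMonoidHom] at this
    rw [← he m, MulEquiv.symm_apply_apply] at this
    exact this

/-- **Lemma 3.5 (i), `P^rlf` portion, for any realification** (pp. 75–76): if `ρ : P → R` exhibits `R`
as the realification of the perf-factorial, group-saturated submonoid `P` of `Q` (`ℝ` supporting `Q`),
the inclusion `P ↪ Q` extends UNIQUELY along `ρ` to `R → Q`, and every such extension is INJECTIVE.
[cite: MochizukiEtTh2009, Lem 3.5 p.75] -/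
theorem rlf_extension_via (hP : IsPerfFactorial P) (hsat : IsGroupSaturated P)
    (hR : Supports Q MonoidType.R) (R : Type u) [CommMonoid R] (ρ : P →* R) (e : R ≃* hP.Rlf)
    (he : ∀ m : P, e (ρ m) = hP.toRealification (Perfection.of P m)) :
    (∃! ι : R →* Q, ι.comp ρ = P.subtype) ∧ ∀ ι : R →* Q, ι.comp ρ = P.subtype → Injective ι := by
  obtain ⟨φ, hφ, huniq⟩ := existsUnique_rlf_extension P hR hP
  refine ⟨⟨φ.comp e.toMonoidHom, ?_, fun ι hι => ?_⟩, fun ι hι => ?_⟩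
  · ext m
    show φ (e (ρ m)) = m
    rw [he m]
    exact DFunLike.congr_fun hφ m
  · have h1 := huniq (ι.comp e.symm.toMonoidHom) ((comp_eq_subtype_iff P hP ρ e he ι).mp hι)
    ext r
    have := DFunLike.congr_fun h1 (e r)
    simp only [MonoidHom.comp_apply, MulEquiv.coe_toMonoidHom, MulEquiv.symm_apply_apply] at this
    rw [MonoidHom.comp_apply, MulEquiv.coe_toMonoidHom, ← this]
  · have hinj := rlf_extension_injective P hR hP hsat _ ((comp_eq_subtype_iff P hP ρ e he ι).mp hι)
    intro r r' hrr'
    apply e.injective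
    apply hinj
    simpa only [MonoidHom.comp_apply, MulEquiv.coe_toMonoidHom, MulEquiv.symm_apply_apply] using hrr'

/-- **Lemma 3.5 (ii), `P^rlf` portion, for any realification** (p. 75): every extension `R → Q` of the
inclusion along a realification `ρ : P → R` has group-saturated image in `Q`.
[cite: MochizukiEtTh2009, Lem 3.5 p.75] -/
theorem isGroupSaturated_rlf_extension_via (hP : IsPerfFactorial P) (hsat : IsGroupSaturated P)
    (hR : Supports Q MonoidType.R) (R : Type u) [CommMonoid R] (ρ : P →* R) (e : R ≃* hP.Rlf)
    (he : ∀ m : P, e (ρ m) = hP.toRealification (Perfection.of P m)) (ι : R →* Q)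
    (hι : ι.comp ρ = P.subtype) : IsGroupSaturated (MonoidHom.mrange ι) := by
  have hsatR := isGroupSaturated_mrange_rlf_extension P hR hP hsat _
    ((comp_eq_subtype_iff P hP ρ e he ι).mp hι)
  have hr : MonoidHom.mrange (ι.comp e.symm.toMonoidHom) = MonoidHom.mrange ι := by
    apply le_antisymm
    · rintro _ ⟨x, rfl⟩
      exact ⟨e.symm x, rfl⟩
    · rintro _ ⟨r, rfl⟩
      exact ⟨e r, by simp only [MonoidHom.comp_apply, MulEquiv.coe_toMonoidHom, MulEquiv.symm_apply_apply]⟩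
  rwa [hr] at hsatR

end Lemma35

end Literature.AnabelianGeometry.EtaleTheta
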